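import Mathlib
import Literature.MathematicalPhysics.QuantumFieldTheory.Balaban1983to89.T4HaarSU2ExpChart
import Summits.QuantumFields.YangMills.Theorems.LuscherReductionOneSiteLevelsMagnetic
import Summits.QuantumFields.YangMills.Theorems.FemtoTransferGap
import HarnessLib

/-!
# The one-link atom of the twist-eater volume law: `Haar{2 − Re tr U ≤ t} = (2/(3π))·t^{3/2}·(1 ± t)` on `SU(2)`
# (BC5 rung `stub_rung_oneLink` of planner ym-idea-4's skeleton `bc/g15-A/TubeVolumeLaw_birth.lean`, crux ⟨24319⟩
# `TwistEaterVolume.TubeVolumeLaw`; free-hands work of the LEAD seat ym-line-sfw-p2 g74)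

The «twist-eater volume» line (route `TwistEaterVolume`, DRAFT by design) reads the sharp twisted Laplace law off a
SUBLEVEL-VOLUME law `μ{F ≤ t} = v·t^N·(1 ± κt)` with exponent `N = dim/2` and a LINEAR correction.  Its BC5 rung is the
one-link atom of that law: for ONE `SU(2)` link with normalised Haar measure, the deficit `2 − Re tr U` has the small-ball
law `Haar{2 − Re tr U ≤ t} = (2/(3π))·t^{3/2}·(1 + O(t))` — exponent `3/2 = dim SU(2)/2`, Weyl density `(2/π) sin²θ`.

Proof.  In the tree's exponential chart (`T4HaarSU2ExpChart`: Haar = push-forward of `(2π²)⁻¹ sinc²‖x‖ 𝟙_{‖x‖<π} d³x`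
under `x ↦ exp(ιx)`), `Re tr exp(ιx) = 2cos‖x‖`, so the trace neighbourhood is the chart ball `‖x‖ ≤ r`,
`cos r = 1 − t/2`; radial integration (`integral_fun_norm_addHaar`, `vol B³ = 4π/3`) gives the EXACT mass
`(2/π)·∫₀ʳ sin²` ; the elementary bounds `s² − (5/12)s⁴ ≤ sin² s ≤ s²` (`Real.cos_bound`) and
`r² − (5/48)r⁴ ≤ t ≤ r²` then give `(1 − t)·v·t^{3/2} ≤ mass ≤ (1 + t)·v·t^{3/2}` for `0 < t ≤ 1/5`, `v = 2/(3π)`.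

HONEST LABEL: a plan-only BC5 rung (one compact-group integral); it is NOT in the composition of the crux; no crux, rung of
the ladder, leaf or summit statement is proved here; the Yang–Mills mass gap is NOT proved by this.
-/

noncomputable section

namespace Summit.QuantumFields.YangMills.Theorems.TwistEaterVolume.OneLink

open MeasureTheory Set Real Metric Filter
open Literature.MathematicalPhysics.QuantumFieldTheory (haarProbability)
open Literature.MathematicalPhysics.QuantumFieldTheory.Balaban1983to89.T4HaarSU2ExpChart
open Summit.QuantumFields.YangMills.Theorems.FemtoTransferGap (SU2 su2Rep)

/-! ## §1 The trace neighbourhood in the exponential chart -/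

/-- The trace neighbourhood of the identity `{U : 2 − Re tr U ≤ t}`. -/
def traceNbhd (t : ℝ) : Set SU2 := {U : SU2 | 2 - ((su2Rep U).trace).re ≤ t}

/-- `U ↦ Re tr U` is continuous on `SU(2)`. -/
theorem continuous_re_trace : Continuous fun U : SU2 => ((su2Rep U).trace).re :=
  Complex.continuous_re.comp (continuous_subtype_val.matrix_trace)

/-- The trace neighbourhood is closed, hence measurable. -/
theorem measurableSet_traceNbhd (t : ℝ) : MeasurableSet (traceNbhd t) :=
  (isClosed_le (continuous_const.sub continuous_re_trace) continuous_const).measurableSet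

/-- In the exponential chart `Re tr exp(ιx) = 2 cos ‖x‖`. -/
theorem re_trace_expPoint (x : EuclideanSpace ℝ (Fin 3)) :
    ((su2Rep (expPoint x)).trace).re = 2 * Real.cos ‖x‖ := by
  have h := Summit.QuantumFields.YangMills.Theorems.FemtoTransferGap.su2_trace_re_eq_quat (expPoint x)
  rw [su2Quat_expPoint, exp_imQuat_re] at h
  exact h

/-- The chart radius of the trace neighbourhood: `cos r(t) = 1 − t/2`. -/
def radius (t : ℝ) : ℝ := Real.arccos (1 - t / 2)

/-- `cos r(t) = 1 − t/2` for `0 ≤ t ≤ 4`. -/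
theorem cos_radius {t : ℝ} (ht0 : 0 ≤ t) (ht4 : t ≤ 4) : Real.cos (radius t) = 1 - t / 2 := by
  unfold radius
  rw [Real.cos_arccos (by linarith) (by linarith)]

/-- `0 ≤ r(t)`. -/
theorem radius_nonneg (t : ℝ) : 0 ≤ radius t := Real.arccos_nonneg _

/-- `r(t) ≤ π`. -/
theorem radius_le_pi (t : ℝ) : radius t ≤ π := Real.arccos_le_pi _

/-- For `t ≤ 1/5` the chart radius is at most `1/2` (`cos(1/2) < 9/10 ≤ 1 − t/2`). -/
theorem radius_le_half {t : ℝ} (ht0 : 0 ≤ t) (ht : t ≤ 1 / 5) : radius t ≤ 1 / 2 := by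
  rcases le_or_gt (radius t) (1 / 2) with h | h
  · exact h
  exfalso
  have hcos : Real.cos (radius t) < Real.cos (1 / 2) :=
    Real.cos_lt_cos_of_nonneg_of_le_pi (by norm_num) (radius_le_pi t) h
  rw [cos_radius ht0 (by linarith)] at hcos
  have hb := Real.cos_bound (show |(1 / 2 : ℝ)| ≤ 1 by norm_num)
  rw [abs_le] at hb
  norm_num at hb
  linarith [hb.2]

/-- The chart preimage of the trace neighbourhood, inside the chart ball, is the closed ball of radius `r(t)`. -/
theorem preimage_traceNbhd_inter_ball {t : ℝ} (ht0 : 0 ≤ t) (ht : t ≤ 1 / 5) :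
    expPoint ⁻¹' traceNbhd t ∩ ball (0 : EuclideanSpace ℝ (Fin 3)) π =
      closedBall (0 : EuclideanSpace ℝ (Fin 3)) (radius t) := by
  have hr := radius_le_half ht0 ht
  have hcr := cos_radius ht0 (by linarith)
  ext x
  simp only [mem_inter_iff, mem_preimage, traceNbhd, mem_setOf_eq, re_trace_expPoint, mem_ball_zero_iff,
    mem_closedBall_zero_iff]
  constructor
  · rintro ⟨h1, h2⟩
    rcases le_or_gt ‖x‖ (radius t) with h | h
    · exact h
    exfalso
    have := Real.cos_lt_cos_of_nonneg_of_le_pi (radius_nonneg t) h2.le h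
    rw [hcr] at this
    linarith
  · intro h
    refine ⟨?_, lt_of_le_of_lt h (by linarith [Real.pi_gt_three])⟩
    have := Real.cos_le_cos_of_nonneg_of_le_pi (norm_nonneg x) (radius_le_pi t) h
    rw [hcr] at this
    linarith

/-! ## §2 The exact Haar mass of the trace neighbourhood: `(2/π)·∫₀ʳ sin²` -/

/-- The radial profile of the exponential-chart Haar weight, `w(y) = (2π²)⁻¹ sinc² y` (so `expWeight x = w ‖x‖`). -/
def radialWeight (y : ℝ) : ℝ := (2 * π ^ 2)⁻¹ * Real.sinc y ^ 2

/-- The chart weight is the radial profile of the norm. -/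
theorem expWeight_eq_radialWeight (x : EuclideanSpace ℝ (Fin 3)) : expWeight x = radialWeight ‖x‖ := rfl

/-- STEP A: `Haar.real{2 − Re tr U ≤ t} = ∫_{ℝ³} 𝟙_{‖x‖ ≤ r(t)} w(‖x‖) dx` (push-forward identity of the exponential chart). -/
theorem haarReal_traceNbhd_eq_integral {t : ℝ} (ht0 : 0 ≤ t) (ht : t ≤ 1 / 5) :
    (haarProbability SU2).real (traceNbhd t) =
      ∫ x : EuclideanSpace ℝ (Fin 3), (Iic (radius t)).indicator radialWeight ‖x‖ := by
  have hS := measurableSet_traceNbhd t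
  have hpre := preimage_traceNbhd_inter_ball ht0 ht
  -- Haar mass as an integral of the indicator, then the chart formula
  rw [← integral_indicator_one hS,
    integral_haarProbability_su2_exp _ ((measurable_one.indicator hS).aestronglyMeasurable)]
  -- on the chart ball the integrand is the indicator of the closed chart ball times the weight
  have h1 : ∀ x ∈ ball (0 : EuclideanSpace ℝ (Fin 3)) π,
      expWeight x • (traceNbhd t).indicator (1 : SU2 → ℝ) (expPoint x) =
        (Iic (radius t)).indicator radialWeight ‖x‖ := by
    intro x hx
    have hiff : expPoint x ∈ traceNbhd t ↔ ‖x‖ ≤ radius t := by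
      have := Set.ext_iff.1 hpre x
      simp only [mem_inter_iff, mem_preimage, mem_closedBall_zero_iff] at this
      exact ⟨fun h => this.1 ⟨h, hx⟩, fun h => (this.2 h).1⟩
    by_cases hm : ‖x‖ ≤ radius t
    · rw [indicator_of_mem (hiff.2 hm), indicator_of_mem (show ‖x‖ ∈ Iic (radius t) from hm),
        expWeight_eq_radialWeight, Pi.one_apply, smul_eq_mul, mul_one]
    · rw [indicator_of_notMem (fun h => hm (hiff.1 h)),
        indicator_of_notMem (show ‖x‖ ∉ Iic (radius t) from hm), smul_zero]
  rw [setIntegral_congr_fun measurableSet_ball h1]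
  -- the integrand vanishes off the chart ball (`r(t) ≤ 1/2 < π`)
  refine setIntegral_eq_integral_of_forall_compl_eq_zero fun x hx => ?_
  have hr := radius_le_half ht0 ht
  rw [mem_ball_zero_iff, not_lt] at hx
  exact indicator_of_notMem (show ‖x‖ ∉ Iic (radius t) from fun h => by
    have := Real.pi_gt_three; simp only [mem_Iic] at h; linarith) _

/-- STEP B: radial integration on `ℝ³` (`vol B³ = 4π/3`): `∫ 𝟙_{‖x‖≤r} w(‖x‖) dx = 4π ∫_{(0,r]} y² w(y) dy`. -/
theorem integral_indicator_radialWeight (r : ℝ) :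
    ∫ x : EuclideanSpace ℝ (Fin 3), (Iic r).indicator radialWeight ‖x‖ =
      4 * π * ∫ y in Ioc 0 r, y ^ 2 * radialWeight y := by
  have h := integral_fun_norm_addHaar (volume : Measure (EuclideanSpace ℝ (Fin 3))) ((Iic r).indicator radialWeight)
  rw [finrank_euclideanSpace_fin] at h
  rw [h]
  have hvol : (volume : Measure (EuclideanSpace ℝ (Fin 3))).real (ball 0 1) = π * 4 / 3 := by
    rw [measureReal_def, EuclideanSpace.volume_ball_fin_three, ENNReal.ofReal_one, one_pow, one_mul,
      ENNReal.toReal_ofReal (by positivity)]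
  rw [hvol]
  have hind : ∀ y : ℝ, y ^ (3 - 1) • (Iic r).indicator radialWeight y =
      (Iic r).indicator (fun y => y ^ 2 * radialWeight y) y := by
    intro y
    by_cases hy : y ∈ Iic r
    · rw [indicator_of_mem hy, indicator_of_mem hy, smul_eq_mul]
    · rw [indicator_of_notMem hy, indicator_of_notMem hy, smul_zero]
  simp_rw [hind]
  rw [setIntegral_indicator measurableSet_Iic, Ioi_inter_Iic, nsmul_eq_mul, smul_eq_mul]
  push_cast
  ring

/-- STEP C: `∫_{(0,r]} y² w(y) dy = (2π²)⁻¹ ∫₀ʳ sin² y dy` (`y² sinc² y = sin² y`). -/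
theorem integral_Ioc_sq_mul_radialWeight {r : ℝ} (hr : 0 ≤ r) :
    ∫ y in Ioc 0 r, y ^ 2 * radialWeight y = (2 * π ^ 2)⁻¹ * ∫ y in (0:ℝ)..r, Real.sin y ^ 2 := by
  rw [intervalIntegral.integral_of_le hr, ← integral_const_mul]
  refine setIntegral_congr_fun measurableSet_Ioc fun y hy => ?_
  unfold radialWeight
  rw [← sq_mul_sinc_sq (ne_of_gt hy.1)]
  ring

/-- ★ THE EXACT MASS: `Haar{2 − Re tr U ≤ t} = (2/π)·∫₀^{r(t)} sin²`, `cos r(t) = 1 − t/2` (`0 ≤ t ≤ 1/5`). -/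
theorem haarReal_traceNbhd {t : ℝ} (ht0 : 0 ≤ t) (ht : t ≤ 1 / 5) :
    (haarProbability SU2).real (traceNbhd t) = 2 / π * ∫ y in (0:ℝ)..radius t, Real.sin y ^ 2 := by
  rw [haarReal_traceNbhd_eq_integral ht0 ht, integral_indicator_radialWeight,
    integral_Ioc_sq_mul_radialWeight (radius_nonneg t)]
  have hπ : (π : ℝ) ≠ 0 := Real.pi_pos.ne'
  field_simp
  ring

/-! ## §3 Elementary bounds: `∫₀ʳ sin²` against `r³/3`, and `t = 2 − 2cos r` against `r²` -/

/-- `sin² s ≤ s²` for `s ≥ 0`. -/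
theorem sin_sq_le_sq {s : ℝ} (hs : 0 ≤ s) (hs1 : s ≤ 1) : Real.sin s ^ 2 ≤ s ^ 2 :=
  pow_le_pow_left₀ (Real.sin_nonneg_of_nonneg_of_le_pi hs (by linarith [Real.pi_gt_three])) (Real.sin_le hs) 2

/-- `s² − (5/12)s⁴ ≤ sin² s` for `0 ≤ s ≤ 1/2` (from `cos 2s ≤ 1 − 2s² + (5/96)(2s)⁴`). -/
theorem sq_sub_le_sin_sq {s : ℝ} (hs : 0 ≤ s) (hs2 : s ≤ 1 / 2) :
    s ^ 2 - 5 / 12 * s ^ 4 ≤ Real.sin s ^ 2 := by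
  have hb := Real.cos_bound (show |2 * s| ≤ 1 by rw [abs_of_nonneg (by linarith)]; linarith)
  rw [abs_of_nonneg (show (0:ℝ) ≤ 2 * s by linarith)] at hb
  have h2 := (abs_le.1 hb).2
  rw [Real.sin_sq_eq_half_sub]
  nlinarith [h2]

/-- Upper bound `∫₀ʳ sin² ≤ r³/3` (`0 ≤ r ≤ 1`). -/
theorem integral_sin_sq_le {r : ℝ} (hr : 0 ≤ r) (hr1 : r ≤ 1) :
    ∫ y in (0:ℝ)..r, Real.sin y ^ 2 ≤ r ^ 3 / 3 := by
  have hi1 : IntervalIntegrable (fun y => Real.sin y ^ 2) volume 0 r :=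
    (by fun_prop : Continuous fun y => Real.sin y ^ 2).intervalIntegrable 0 r
  have hi2 : IntervalIntegrable (fun y : ℝ => y ^ 2) volume 0 r :=
    (by fun_prop : Continuous fun y : ℝ => y ^ 2).intervalIntegrable 0 r
  have h : ∫ y in (0:ℝ)..r, Real.sin y ^ 2 ≤ ∫ y in (0:ℝ)..r, y ^ 2 :=
    intervalIntegral.integral_mono_on hr hi1 hi2 fun y hy => sin_sq_le_sq hy.1 (hy.2.trans hr1)
  have e : ∫ y in (0:ℝ)..r, y ^ 2 = r ^ 3 / 3 := by rw [integral_pow]; norm_num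
  linarith

/-- Lower bound `r³/3 − r⁵/12 ≤ ∫₀ʳ sin²` (`0 ≤ r ≤ 1/2`). -/
theorem integral_sin_sq_ge {r : ℝ} (hr : 0 ≤ r) (hr2 : r ≤ 1 / 2) :
    r ^ 3 / 3 - r ^ 5 / 12 ≤ ∫ y in (0:ℝ)..r, Real.sin y ^ 2 := by
  have hi1 : IntervalIntegrable (fun y => Real.sin y ^ 2) volume 0 r :=
    (by fun_prop : Continuous fun y => Real.sin y ^ 2).intervalIntegrable 0 r
  have hi2 : IntervalIntegrable (fun y : ℝ => y ^ 2) volume 0 r :=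
    (by fun_prop : Continuous fun y : ℝ => y ^ 2).intervalIntegrable 0 r
  have hi4 : IntervalIntegrable (fun y : ℝ => 5 / 12 * y ^ 4) volume 0 r :=
    (by fun_prop : Continuous fun y : ℝ => 5 / 12 * y ^ 4).intervalIntegrable 0 r
  have h : ∫ y in (0:ℝ)..r, (y ^ 2 - 5 / 12 * y ^ 4) ≤ ∫ y in (0:ℝ)..r, Real.sin y ^ 2 :=
    intervalIntegral.integral_mono_on hr (hi2.sub hi4) hi1 fun y hy => sq_sub_le_sin_sq hy.1 (hy.2.trans hr2)
  have e : ∫ y in (0:ℝ)..r, (y ^ 2 - 5 / 12 * y ^ 4) = r ^ 3 / 3 - r ^ 5 / 12 := by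
    rw [intervalIntegral.integral_sub hi2 hi4, intervalIntegral.integral_const_mul, integral_pow, integral_pow]
    norm_num
  linarith

/-- `t ≤ r(t)²` (from `cos r ≥ 1 − r²/2`). -/
theorem le_radius_sq {t : ℝ} (ht0 : 0 ≤ t) (ht4 : t ≤ 4) : t ≤ radius t ^ 2 := by
  have h := Real.one_sub_sq_div_two_le_cos (x := radius t)
  rw [cos_radius ht0 ht4] at h
  linarith

/-- `r(t)² − (5/48) r(t)⁴ ≤ t` (from `cos r ≤ 1 − r²/2 + (5/96) r⁴`, `r ≤ 1`). -/
theorem radius_sq_sub_le {t : ℝ} (ht0 : 0 ≤ t) (ht : t ≤ 1 / 5) :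
    radius t ^ 2 - 5 / 48 * radius t ^ 4 ≤ t := by
  have hr := radius_le_half ht0 ht
  have hr0 := radius_nonneg t
  have hb := Real.cos_bound (show |radius t| ≤ 1 by rw [abs_of_nonneg hr0]; linarith)
  rw [abs_of_nonneg hr0, cos_radius ht0 (by linarith)] at hb
  have h2 := (abs_le.1 hb).2
  linarith

/-- Two-sided sandwich `(1 − t)·(2/(3π))·t√t ≤ Haar{2 − Re tr U ≤ t} ≤ (1 + t)·(2/(3π))·t√t` for `0 < t ≤ 1/5`. -/
theorem haarReal_traceNbhd_sandwich {t : ℝ} (ht0 : 0 < t) (ht : t ≤ 1 / 5) :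
    (1 - t) * (2 / (3 * π) * (t * Real.sqrt t)) ≤ (haarProbability SU2).real (traceNbhd t) ∧
      (haarProbability SU2).real (traceNbhd t) ≤ (1 + t) * (2 / (3 * π) * (t * Real.sqrt t)) := by
  rw [haarReal_traceNbhd ht0.le ht]
  set r := radius t with hr_def
  have hr0 : 0 ≤ r := radius_nonneg t
  have hrh : r ≤ 1 / 2 := radius_le_half ht0.le ht
  have hJle := integral_sin_sq_le hr0 (by linarith)
  have hJge := integral_sin_sq_ge hr0 hrh
  have ht_le : t ≤ r ^ 2 := le_radius_sq ht0.le (by linarith)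
  have ht_ge : r ^ 2 - 5 / 48 * r ^ 4 ≤ t := radius_sq_sub_le ht0.le ht
  have hπ : 0 < π := Real.pi_pos
  -- `√t ≤ r` and `r·w ≤ √t` with `w = 1 − (5/48) r²`
  have hsqrt_le : Real.sqrt t ≤ r := by
    rw [Real.sqrt_le_left hr0] ; exact ht_le
  have hw0 : 0 ≤ 1 - 5 / 48 * r ^ 2 := by nlinarith
  have hw1 : 1 - 5 / 48 * r ^ 2 ≤ 1 := by nlinarith
  have hsqrt_ge : r * (1 - 5 / 48 * r ^ 2) ≤ Real.sqrt t := by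
    rw [Real.le_sqrt (by positivity) ht0.le]
    -- (r w)² = r² w² ≤ r² w = r² − (5/48) r⁴ ≤ t
    nlinarith [mul_le_mul_of_nonneg_left hw1 (mul_nonneg (sq_nonneg r) hw0)]
  set J := ∫ y in (0:ℝ)..r, Real.sin y ^ 2 with hJ
  constructor
  · -- lower: (1 - t) t √t ≤ 3 J
    have hst : Real.sqrt t ≤ r := hsqrt_le
    have h1 : t * Real.sqrt t ≤ r ^ 2 * r := mul_le_mul ht_le hst (Real.sqrt_nonneg _) (sq_nonneg _)
    have key : (1 - t) * (t * Real.sqrt t) ≤ 3 * J := by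
      rcases le_or_gt t 1 with h | h
      · have h2 : (1 - t) * (t * Real.sqrt t) ≤ (1 - t) * (r ^ 2 * r) :=
          mul_le_mul_of_nonneg_left h1 (by linarith)
        have h3 : (1 - t) * (r ^ 2 * r) ≤ (1 - (r ^ 2 - 5 / 48 * r ^ 4)) * (r ^ 2 * r) :=
          mul_le_mul_of_nonneg_right (by linarith) (by positivity)
        have h4 : (1 - (r ^ 2 - 5 / 48 * r ^ 4)) * (r ^ 2 * r) ≤ 3 * J := by
          have h5 : 0 ≤ r ^ 5 * (3 / 4 - 5 / 48 * r ^ 2) :=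
            mul_nonneg (pow_nonneg hr0 5) (by nlinarith)
          nlinarith [hJge, h5]
        linarith [h2, h3, h4]
      · linarith
    have : (1 - t) * (2 / (3 * π) * (t * Real.sqrt t)) = 2 / (3 * π) * ((1 - t) * (t * Real.sqrt t)) := by ring
    rw [this]
    have : 2 / π * J = 2 / (3 * π) * (3 * J) := by field_simp
    rw [this]
    exact mul_le_mul_of_nonneg_left key (by positivity)
  · -- upper: 3 J ≤ r³ ≤ (1 + t) t √t
    have h1 : r ^ 2 * (1 - 5 / 48 * r ^ 2) * (r * (1 - 5 / 48 * r ^ 2)) ≤ t * Real.sqrt t :=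
      mul_le_mul (by nlinarith) hsqrt_ge (by positivity) ht0.le
    have key : 3 * J ≤ (1 + t) * (t * Real.sqrt t) := by
      have h2 : (1 + (r ^ 2 - 5 / 48 * r ^ 4)) * (r ^ 2 * (1 - 5 / 48 * r ^ 2) * (r * (1 - 5 / 48 * r ^ 2)))
          ≤ (1 + t) * (t * Real.sqrt t) :=
        mul_le_mul (by linarith) h1 (by positivity) (by linarith)
      -- r³ ≤ (1 + r² w)·r³·w³  (polynomial in r, r ≤ 1/2)
      have h3 : r ^ 3 ≤ (1 + (r ^ 2 - 5 / 48 * r ^ 4)) * (r ^ 2 * (1 - 5 / 48 * r ^ 2) * (r * (1 - 5 / 48 * r ^ 2))) := by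
        have hr2 : r ^ 2 ≤ 1 / 4 := by nlinarith
        nlinarith [pow_nonneg hr0 3, pow_nonneg hr0 5, pow_nonneg hr0 7, pow_nonneg hr0 9, sq_nonneg r,
          mul_nonneg (pow_nonneg hr0 3) (sub_nonneg.2 hr2)]
      nlinarith [hJle]
    have : (1 + t) * (2 / (3 * π) * (t * Real.sqrt t)) = 2 / (3 * π) * ((1 + t) * (t * Real.sqrt t)) := by ring
    rw [this]
    have : 2 / π * J = 2 / (3 * π) * (3 * J) := by field_simp
    rw [this]
    exact mul_le_mul_of_nonneg_left key (by positivity)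

end Summit.QuantumFields.YangMills.Theorems.TwistEaterVolume.OneLink

/-! ## §4 The rung BY NAME (namespace of the registered skeleton `TubeVolumeLaw_birth`) -/

namespace Summit.QuantumFields.YangMills.Cruxes.TubeVolumeLaw.Birth

open MeasureTheory Set Real
open Literature.MathematicalPhysics.QuantumFieldTheory (haarProbability)
open Summit.QuantumFields.YangMills.Theorems.FemtoTransferGap (SU2 su2Rep)
open Summit.QuantumFields.YangMills.Theorems.TwistEaterVolume.OneLink

/-- ★★ THE RUNG (`stub_rung_oneLink` of `bc/g15-A/TubeVolumeLaw_birth.lean`, verbatim statement): the one-link Haar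
small-ball law on `SU(2)` with exponent `3/2` and a LINEAR correction — `v = 2/(3π)`, `κ = 1`, `t₀ = 1/5`. -/
theorem stub_rung_oneLink :
    ∃ v : ℝ, 0 < v ∧ ∃ κ : ℝ, 0 ≤ κ ∧ ∃ t₀ : ℝ, 0 < t₀ ∧ ∀ t : ℝ, 0 < t → t ≤ t₀ →
      |(haarProbability SU2).real {U : SU2 | 2 - ((su2Rep U).trace).re ≤ t} / (v * t ^ ((3 : ℝ) / 2)) - 1| ≤ κ * t := by
  refine ⟨2 / (3 * π), by positivity, 1, zero_le_one, 1 / 5, by norm_num, fun t ht0 ht => ?_⟩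
  have hV : t ^ ((3 : ℝ) / 2) = t * Real.sqrt t := by
    rw [show (3 : ℝ) / 2 = 1 + 1 / 2 by norm_num, Real.rpow_add ht0, Real.rpow_one, Real.sqrt_eq_rpow]
  obtain ⟨hL, hU⟩ := haarReal_traceNbhd_sandwich ht0 ht
  have hVpos : 0 < 2 / (3 * π) * (t * Real.sqrt t) := by
    have := Real.pi_pos; have := Real.sqrt_pos.2 ht0; positivity
  change |(haarProbability SU2).real (traceNbhd t) / _ - 1| ≤ 1 * t
  rw [hV, one_mul, abs_sub_le_iff, div_sub_one hVpos.ne', sub_le_comm, div_le_iff₀ hVpos,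
    le_div_iff₀ hVpos]
  constructor <;> nlinarith [hL, hU]

end Summit.QuantumFields.YangMills.Cruxes.TubeVolumeLaw.Birth

end
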